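/-
Copyright (c) 2026. All rights reserved.
Released under Apache 2.0 license as described in the file LICENSE.
-/
import Summits.HubbardSuperconductivity.HubbardLadder.Bounds.SectorTwistRatio
import HarnessLib

/-!
# The adjacent-sector ratio bound from the dressing bound (bounds.tex §13, Lemma 13.6)

HONEST FRAMING: ladder R1–R4 with certified numbers; no claim on H/H₀. These are bounds for
MODEL CLASSES (the typed repulsive/attractive Hubbard torus with a flux twist), no materials
claim. This part spells out the two remaining MODEL INPUTS of the N-sector device (as the
hypotheses `hid`, `hD` of its main theorem — the successor proves them) and PROVES the
trace-inequality step from them to the ratio bound consumed by `SectorRatioEnvelope`: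

* W1a (hypothesis `hid`; pure CAR bookkeeping): with `n = |Orb Λ_L|`, `H = H^{tt'}_L(0)`,
  `G = e^{-βH}`, `P_k = numberSectorProj _ k` the particle-number projections and
  `X_i = e^{-βH} c_i e^{βH} - c_i`,
  `(n - k) Z_k - (k+1) Z_{k+1} = Σ_i Tr(c†_i X_i (P_{k+1} G P_{k+1}))`
  (from `Σ_i c_i c†_i = n - N̂`, cyclicity, `P_k c_i = c_i P_{k+1}`, `[H, N̂] = 0`);
* W2 (hypothesis `hD`; to be proved with a volume-independent `r = r(β, t', U)` by the
  imaginary-time commutator series): `‖X_i‖ ≤ r` for all `i`;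
* W1b (conclusion): `|(n - k) w_k - (k+1) w_{k+1}| ≤ n r w_{k+1}` (`k + 1 ≤ n`) for
  `w = ttSectorWeight L β t' U` — VERBATIM the hypothesis `hratio` of
  `SectorRatioEnvelope.walk_input_of_ratio_bound`;
* `sectorRatioBound_of_identity_of_dressing` (PROVED): W1a → W2 → W1b, by
  `‖Tr(A Y)‖ ≤ ‖A‖ Re Tr Y` for the positive semidefinite `Y = P_{k+1} e^{-βH} P_{k+1}`
  (`norm_trace_mul_le_opNorm_mul_re_trace`, Koma–Tasaki), `Re Tr Y = Z_{k+1}` and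
  `‖c†_i X_i‖ ≤ r`.

No numerics, no `native_decide`; standard axioms only. References: folklore (CAR algebra,
Gibbs-state trace inequalities); programme notes bounds.tex §13.
-/

noncomputable section

namespace Summit.HubbardSuperconductivity.HubbardLadder.Bounds

open Matrix Finset Complex
open Literature.MathematicalPhysics.QuantumLattice
open scoped Matrix.Norms.L2Operator ComplexOrder

/-! ### The particle-number projections -/

section Proj

variable {ι : Type*} [DecidableEq ι]

/-- The projection `P_k` onto the total-particle-number sector `N̂ = k` of the fermionic Fock
space over the orbital set `ι`: the diagonal `0/1` matrix in the occupation basis. [folklore] -/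
def numberSectorProj (ι : Type*) [DecidableEq ι] (k : ℕ) : Matrix (Finset ι) (Finset ι) ℂ :=
  diagonal fun s => if s.card = k then 1 else 0

/-- `P_k` is Hermitian. [folklore] -/
theorem conjTranspose_numberSectorProj (k : ℕ) :
    (numberSectorProj ι k)ᴴ = numberSectorProj ι k := by
  rw [numberSectorProj, diagonal_conjTranspose]
  congr 1
  funext s
  simp only [Pi.star_apply]
  split_ifs <;> simp

variable [Fintype ι]

/-- `P_k² = P_k`. [folklore] -/
theorem numberSectorProj_mul_self (k : ℕ) :
    numberSectorProj ι k * numberSectorProj ι k = numberSectorProj ι k := by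
  rw [numberSectorProj, diagonal_mul_diagonal]
  congr 1
  funext s
  split_ifs <;> simp

/-- `Tr(G P_k) = Σ_{#s = k} G_{ss}`. [folklore] -/
theorem trace_mul_numberSectorProj (G : Matrix (Finset ι) (Finset ι) ℂ) (k : ℕ) :
    (G * numberSectorProj ι k).trace =
      ∑ s ∈ Finset.univ.filter (fun s : Finset ι => s.card = k), G s s := by
  rw [numberSectorProj, Matrix.trace, Finset.sum_filter]
  refine Finset.sum_congr rfl fun s _ => ?_
  rw [diag_apply, mul_diagonal]
  split_ifs <;> simp

/-- `Tr(P_k G P_k) = Σ_{#s = k} G_{ss}`. [folklore] -/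
theorem trace_numberSectorProj_mul_mul (G : Matrix (Finset ι) (Finset ι) ℂ) (k : ℕ) :
    (numberSectorProj ι k * G * numberSectorProj ι k).trace =
      ∑ s ∈ Finset.univ.filter (fun s : Finset ι => s.card = k), G s s := by
  rw [Matrix.mul_assoc, trace_mul_comm, Matrix.mul_assoc, numberSectorProj_mul_self,
    trace_mul_numberSectorProj]

/-- `P_k G P_k ≥ 0` for `G ≥ 0`. [folklore] -/
theorem posSemidef_numberSectorProj_mul_mul {G : Matrix (Finset ι) (Finset ι) ℂ}
    (hG : G.PosSemidef) (k : ℕ) :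
    (numberSectorProj ι k * G * numberSectorProj ι k).PosSemidef := by
  have h := hG.conjTranspose_mul_mul_same (numberSectorProj ι k)
  rwa [conjTranspose_numberSectorProj] at h

end Proj

/-! ### The ratio bound from the identity and the dressing bound -/

variable {L : ℕ} [NeZero L]


/-- `Re Tr(P_{k+1} e^{-βH} P_{k+1}) = w_{k+1}` and `P_{k+1} e^{-βH} P_{k+1} ≥ 0`. [this file] -/
theorem re_trace_proj_gibbs_proj (β t' U : ℝ) (k : ℕ) :
    ((numberSectorProj (Orb (FermionTorus 2 L)) k * gibbsWeight β (hubbardTorusTT'Flux L t' U 0) *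
        numberSectorProj (Orb (FermionTorus 2 L)) k).trace).re = ttSectorWeight L β t' U k := by
  rw [trace_numberSectorProj_mul_mul, ← ttSectorZ_eq_sum, ttSectorWeight]

/-- ONE TERM: `‖Tr(c†_i X (P G P))‖ ≤ ‖X‖ · w_{k+1}` for `G = e^{-βH}`, `P = P_{k+1}`.
[folklore; this file] -/
theorem norm_trace_creation_mul_mul_proj_le (β t' U : ℝ) (k : ℕ) (i : Orb (FermionTorus 2 L))
    (X : Matrix (Finset (Orb (FermionTorus 2 L))) (Finset (Orb (FermionTorus 2 L))) ℂ) :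
    ‖(creation i * X *
        (numberSectorProj (Orb (FermionTorus 2 L)) k *
          gibbsWeight β (hubbardTorusTT'Flux L t' U 0) *
          numberSectorProj (Orb (FermionTorus 2 L)) k)).trace‖ ≤
      ‖X‖ * ttSectorWeight L β t' U k := by
  have hG : (gibbsWeight β (hubbardTorusTT'Flux L t' U 0)).PosSemidef :=
    (Matrix.posDef_gibbsWeight β (isHermitian_hubbardTorusTT'Flux L t' U 0)).posSemidef
  have hY := posSemidef_numberSectorProj_mul_mul hG k
  rw [← re_trace_proj_gibbs_proj β t' U k]
  refine (norm_trace_mul_le_opNorm_mul_re_trace _ hY).trans ?_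
  have hw : 0 ≤ ((numberSectorProj (Orb (FermionTorus 2 L)) k *
      gibbsWeight β (hubbardTorusTT'Flux L t' U 0) *
      numberSectorProj (Orb (FermionTorus 2 L)) k).trace).re :=
    Complex.nonneg_iff.1 (hY.trace_nonneg) |>.1
  refine mul_le_mul_of_nonneg_right ?_ hw
  calc ‖creation i * X‖ ≤ ‖creation i‖ * ‖X‖ := norm_mul_le _ _
    _ ≤ 1 * ‖X‖ := mul_le_mul_of_nonneg_right (norm_creation_le_one i) (norm_nonneg _)
    _ = ‖X‖ := one_mul _

/-- **W1a → W2 → W1b: the adjacent-sector ratio bound from the sector ratio identity and the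
dressing bound.** Hypotheses (the two remaining MODEL INPUTS of the N-sector device, both about
the untwisted torus `H = H^{tt'}_L(0)`, `n = |Orb Λ_L|`, `X_i = e^{-βH} c_i e^{βH} - c_i`):
`hid` (W1a, pure CAR bookkeeping) `(n - k) Z_k - (k+1) Z_{k+1} = Σ_i Tr(c†_i X_i (P_{k+1} e^{-βH}
P_{k+1}))` for all `k`; `hD` (W2, the imaginary-time dressing bound) `‖X_i‖ ≤ r` for all `i`.
Conclusion (W1b): `|(n - k) w_k - (k+1) w_{k+1}| ≤ n r w_{k+1}` for `k + 1 ≤ n`,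
`w = ttSectorWeight L β t' U` — VERBATIM the hypothesis `hratio` of `walk_input_of_ratio_bound`.
[this file; bounds.tex §13, Lemma 13.6] -/
theorem sectorRatioBound_of_identity_of_dressing {β t' U r : ℝ}
    (hid : ∀ k : ℕ,
      ((Fintype.card (Orb (FermionTorus 2 L)) : ℂ) - k) * ttSectorZ L β t' U 0 k -
          ((k : ℂ) + 1) * ttSectorZ L β t' U 0 (k + 1) =
        ∑ i : Orb (FermionTorus 2 L),
          (creation i *
            (gibbsWeight β (hubbardTorusTT'Flux L t' U 0) * annihilation i *
                gibbsWeight (-β) (hubbardTorusTT'Flux L t' U 0) - annihilation i) *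
            (numberSectorProj (Orb (FermionTorus 2 L)) (k + 1) *
              gibbsWeight β (hubbardTorusTT'Flux L t' U 0) *
              numberSectorProj (Orb (FermionTorus 2 L)) (k + 1))).trace)
    (hD : ∀ i : Orb (FermionTorus 2 L),
      ‖gibbsWeight β (hubbardTorusTT'Flux L t' U 0) * annihilation i *
          gibbsWeight (-β) (hubbardTorusTT'Flux L t' U 0) - annihilation i‖ ≤ r) :
    ∀ k : ℕ, k + 1 ≤ Fintype.card (Orb (FermionTorus 2 L)) →
      |((Fintype.card (Orb (FermionTorus 2 L)) : ℝ) - k) * ttSectorWeight L β t' U k -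
          ((k : ℝ) + 1) * ttSectorWeight L β t' U (k + 1)| ≤
        Fintype.card (Orb (FermionTorus 2 L)) * r * ttSectorWeight L β t' U (k + 1) := by
  intro k hk
  set n := Fintype.card (Orb (FermionTorus 2 L)) with hn
  have hZk : (ttSectorZ L β t' U 0 k).im = 0 := (ttSectorZ_pos β t' U 0 (by omega)).2
  have hZk1 : (ttSectorZ L β t' U 0 (k + 1)).im = 0 := (ttSectorZ_pos β t' U 0 hk).2
  have hre : ((n : ℝ) - k) * ttSectorWeight L β t' U k -
      ((k : ℝ) + 1) * ttSectorWeight L β t' U (k + 1) =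
      (((n : ℂ) - k) * ttSectorZ L β t' U 0 k -
        ((k : ℂ) + 1) * ttSectorZ L β t' U 0 (k + 1)).re := by
    simp only [ttSectorWeight, Complex.sub_re, Complex.mul_re, hZk, hZk1, mul_zero, sub_zero,
      Complex.natCast_re, Complex.add_re, Complex.one_re, Complex.sub_im]
  rw [hre, hid k]
  refine (abs_re_le_norm _).trans ((norm_sum_le _ _).trans ?_)
  calc ∑ i : Orb (FermionTorus 2 L),
        ‖(creation i *
          (gibbsWeight β (hubbardTorusTT'Flux L t' U 0) * annihilation i *
              gibbsWeight (-β) (hubbardTorusTT'Flux L t' U 0) - annihilation i) *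
          (numberSectorProj (Orb (FermionTorus 2 L)) (k + 1) *
            gibbsWeight β (hubbardTorusTT'Flux L t' U 0) *
            numberSectorProj (Orb (FermionTorus 2 L)) (k + 1))).trace‖
      ≤ ∑ _i : Orb (FermionTorus 2 L), r * ttSectorWeight L β t' U (k + 1) :=
        Finset.sum_le_sum fun i _ =>
          (norm_trace_creation_mul_mul_proj_le β t' U (k + 1) i _).trans
            (mul_le_mul_of_nonneg_right (hD i) (ttSectorWeight_pos β t' U hk).le)
    _ = (n : ℝ) * r * ttSectorWeight L β t' U (k + 1) := by
        rw [Finset.sum_const, nsmul_eq_mul, Finset.card_univ, hn]; ring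

end Summit.HubbardSuperconductivity.HubbardLadder.Bounds
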